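import Summits.QuantumFields.YangMills.Theorems.AllWindowsColdBoxBoxHighLineStep2Tilt
import Summits.QuantumFields.YangMills.Theorems.BalabanLadderNTSkewResponseTilt
import Mathlib.Analysis.Calculus.MeanValue

/-!
# T-S5.13t, generic layer: calculus of the exponential tilt `E_t[G] = ∫ G e^{tU} dμ / ∫ e^{tU} dμ`

For a finite non-zero measure `μ` and bounded measurable `U, G, W₁, W₂` (planner ym-idea-2 g18's letters `Tilt.tiltExp / tiltCov / tiltCum3 /
tiltCum4`, ✓`…Step2Tilt`):

* bridge `tiltExp μ U t G = ∫ G ∂(μ.tilted (t·U))` (✓`SkewResponse.integral_tilted_eq_div`), hence `hasDerivAt_tiltExp`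
  (`d/dt E_t[W] = E_t[WU] − E_t[W]E_t[U]`, ✓`SkewResponse.hasDerivAt_integral_tilted`);
* RE-CENTRING: `tiltExp` is invariant under `U ↦ U − c` (`tiltExp_shiftU`) and `tiltCov / tiltCum3 / tiltCum4` under `Gᵢ ↦ Gᵢ − aᵢ`, `U ↦ U − c`;
* in the centred case (`E_{t₀}[W₁] = E_{t₀}[W₂] = E_{t₀}[U] = 0`): `d/dt|_{t₀} tiltCov = tiltCum3(t₀)` (✓`SkewResponse.hasDerivAt_cov_tilted`, the five-term
  third cumulant collapses) and `d/dt|_{t₀} tiltCum3 = tiltCum4(t₀)` (8-term raw expansion of `tiltCum3(t)`, product rule, collapse at `t₀`);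
  the general case by re-centring at `t₀`: **`hasDerivAt_tiltCov`**, **`hasDerivAt_tiltCum3`**;
* `abs_sub_sub_le_of_second_deriv`: `|f 1 − f 0 − f′ 0| ≤ K/2` from `|f″| ≤ K` on `[0,1]` (Mathlib mean-value machinery).

Then the by-name ★`tiltSecondOrder : TiltSecondOrder`.  Tree + Mathlib; no definitions; standard axioms.
HONEST LABEL: abstract measure-theoretic support of STEP 2 (T-S5.13) of the XL stub S5 (LINE-19 ⟨stmt-QuantumFields-24004⟩/⟨24335⟩; U5 ⟨24336⟩);
S5/U5 and route AllWindowsColdBox (DRAFT) remain OPEN; the Yang–Mills mass gap is NOT proved by this file; no summit is proved by a line.  Seat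
ym-line-fcl-p3 g25.
-/

set_option autoImplicit false

noncomputable section

open MeasureTheory Set
open Summit.QuantumFields.YangMills.Cruxes.NT.SkewResponse

namespace Summit.QuantumFields.YangMills.Theorems.AllWindowsColdBoxBoxHighLine

namespace Tilt

variable {Ω : Type*} [MeasurableSpace Ω] {μ : Measure Ω}

/-! ## §1 Bridge to Mathlib's tilted measure; integrability of bounded observables -/

/-- `E_t[G] = ∫ G d(μ.tilted (t·U))`. [folklore] -/
theorem tiltExp_eq_integral_tilted (μ : Measure Ω) (U : Ω → ℝ) (t : ℝ) (G : Ω → ℝ) :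
    tiltExp μ U t G = ∫ x, G x ∂(μ.tilted fun x => t * U x) := by
  rw [integral_tilted_eq_div]; rfl

/-- A bounded measurable function is integrable for a finite measure. [folklore] -/
theorem integrable_of_abs_le {ν : Measure Ω} [IsFiniteMeasure ν] {W : Ω → ℝ} {B : ℝ} (hW : Measurable W)
    (hWb : ∀ x, |W x| ≤ B) : Integrable W ν :=
  Integrable.of_bound hW.aestronglyMeasurable B (ae_of_all _ fun x => by rw [Real.norm_eq_abs]; exact hWb x)

/-- The tilted measure `μ.tilted (t·U)` is a probability measure (`μ ≠ 0` finite, `U` bounded measurable). [folklore] -/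
theorem isProbabilityMeasure_tilted_mul [IsFiniteMeasure μ] [NeZero μ] {U : Ω → ℝ} {BU : ℝ} (hU : Measurable U)
    (hUb : ∀ x, |U x| ≤ BU) (t : ℝ) : IsProbabilityMeasure (μ.tilted fun x => t * U x) :=
  isProbabilityMeasure_tilted (integrable_exp_mul hU hUb t)

omit [MeasurableSpace Ω] in
/-- Bound of a triple product. -/
theorem abs_mul_mul_le {X Y W : Ω → ℝ} {MX MY MW : ℝ} (hX : ∀ x, |X x| ≤ MX) (hY : ∀ x, |Y x| ≤ MY) (hW : ∀ x, |W x| ≤ MW)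
    (x : Ω) : |X x * Y x * W x| ≤ MX * MY * MW := by
  rw [abs_mul]
  have h1 := abs_mul_le_mul hX hY x
  have hMW : 0 ≤ MW := (abs_nonneg _).trans (hW x)
  exact mul_le_mul h1 (hW x) (abs_nonneg _) ((abs_nonneg _).trans h1)

/-! ## §2 The derivative of a tilted expectation -/

/-- **`d/dt E_t[W] = E_t[W·U] − E_t[W]·E_t[U]`.** [folklore] -/
theorem hasDerivAt_tiltExp [IsFiniteMeasure μ] [NeZero μ] {U W : Ω → ℝ} {BU BW : ℝ} (hU : Measurable U) (hW : Measurable W)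
    (hUb : ∀ x, |U x| ≤ BU) (hWb : ∀ x, |W x| ≤ BW) (t₀ : ℝ) :
    HasDerivAt (fun t => tiltExp μ U t W)
      (tiltExp μ U t₀ (fun x => W x * U x) - tiltExp μ U t₀ W * tiltExp μ U t₀ U) t₀ := by
  have h := hasDerivAt_integral_tilted (μ := μ) hU hW hUb hWb t₀
  have e : (fun t => tiltExp μ U t W) = fun t => ∫ x, W x ∂(μ.tilted fun x => t * U x) := by
    funext t; exact tiltExp_eq_integral_tilted μ U t W
  rw [e, tiltExp_eq_integral_tilted, tiltExp_eq_integral_tilted, tiltExp_eq_integral_tilted]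
  exact h

/-! ## §3 Re-centring invariances -/

/-- `E^{U−c}_t = E^{U}_t`: shifting the tilt observable by a constant does not change tilted expectations. [folklore] -/
theorem tiltExp_shiftU (μ : Measure Ω) (U : Ω → ℝ) (c t : ℝ) (G : Ω → ℝ) :
    tiltExp μ (fun x => U x - c) t G = tiltExp μ U t G := by
  unfold tiltExp
  have e : ∀ x, Real.exp (t * (U x - c)) = Real.exp (t * U x) * Real.exp (-(t * c)) := by
    intro x; rw [← Real.exp_add]; ring_nf
  simp_rw [e, ← mul_assoc, integral_mul_const]
  rw [mul_div_mul_right _ _ (Real.exp_pos _).ne']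

/-- `E_t[W − a] = E_t[W] − a`. [folklore] -/
theorem tiltExp_sub_const [IsFiniteMeasure μ] [NeZero μ] {U W : Ω → ℝ} {BU BW : ℝ} (hU : Measurable U) (hW : Measurable W)
    (hUb : ∀ x, |U x| ≤ BU) (hWb : ∀ x, |W x| ≤ BW) (a t : ℝ) :
    tiltExp μ U t (fun x => W x - a) = tiltExp μ U t W - a := by
  haveI := isProbabilityMeasure_tilted_mul (μ := μ) hU hUb t
  rw [tiltExp_eq_integral_tilted, tiltExp_eq_integral_tilted, integral_sub (integrable_of_abs_le hW hWb) (integrable_const a)]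
  simp

/-- `E_t[(W₁ − a)(W₂ − b)] = E_t[W₁W₂] − a E_t[W₂] − b E_t[W₁] + ab`. [folklore] -/
theorem tiltExp_sub_mul_sub [IsFiniteMeasure μ] [NeZero μ] {U W₁ W₂ : Ω → ℝ} {BU B₁ B₂ : ℝ} (hU : Measurable U)
    (h₁ : Measurable W₁) (h₂ : Measurable W₂) (hUb : ∀ x, |U x| ≤ BU) (h₁b : ∀ x, |W₁ x| ≤ B₁) (h₂b : ∀ x, |W₂ x| ≤ B₂)
    (a b t : ℝ) :
    tiltExp μ U t (fun x => (W₁ x - a) * (W₂ x - b)) =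
      tiltExp μ U t (fun x => W₁ x * W₂ x) - a * tiltExp μ U t W₂ - b * tiltExp μ U t W₁ + a * b := by
  haveI := isProbabilityMeasure_tilted_mul (μ := μ) hU hUb t
  simp only [tiltExp_eq_integral_tilted]
  set ν := μ.tilted fun x => t * U x
  have i12 : Integrable (fun x => W₁ x * W₂ x) ν := integrable_of_abs_le (h₁.mul h₂) (abs_mul_le_mul h₁b h₂b)
  have i1 : Integrable (fun x => b * W₁ x) ν := (integrable_of_abs_le h₁ h₁b).const_mul b
  have i2 : Integrable (fun x => a * W₂ x) ν := (integrable_of_abs_le h₂ h₂b).const_mul a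
  have e : (fun x => (W₁ x - a) * (W₂ x - b)) = fun x => W₁ x * W₂ x - a * W₂ x - b * W₁ x + a * b := by
    funext x; ring
  have iB : Integrable (fun x => W₁ x * W₂ x - a * W₂ x) ν := i12.sub i2
  have iA : Integrable (fun x => W₁ x * W₂ x - a * W₂ x - b * W₁ x) ν := iB.sub i1
  rw [e, integral_add iA (integrable_const _), integral_sub iB i1, integral_sub i12 i2,
    integral_const_mul, integral_const_mul]
  simp

/-- The tilted covariance is invariant under constant shifts of the observables. [folklore] -/
theorem tiltCov_shift [IsFiniteMeasure μ] [NeZero μ] {U W₁ W₂ : Ω → ℝ} {BU B₁ B₂ : ℝ} (hU : Measurable U)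
    (h₁ : Measurable W₁) (h₂ : Measurable W₂) (hUb : ∀ x, |U x| ≤ BU) (h₁b : ∀ x, |W₁ x| ≤ B₁) (h₂b : ∀ x, |W₂ x| ≤ B₂)
    (a b t : ℝ) :
    tiltCov μ U t (fun x => W₁ x - a) (fun x => W₂ x - b) = tiltCov μ U t W₁ W₂ := by
  unfold tiltCov
  rw [tiltExp_sub_mul_sub hU h₁ h₂ hUb h₁b h₂b, tiltExp_sub_const hU h₁ hUb h₁b, tiltExp_sub_const hU h₂ hUb h₂b]
  ring

/-- The tilted covariance is invariant under a constant shift of the tilt observable. [folklore] -/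
theorem tiltCov_shiftU (μ : Measure Ω) (U : Ω → ℝ) (c t : ℝ) (W₁ W₂ : Ω → ℝ) :
    tiltCov μ (fun x => U x - c) t W₁ W₂ = tiltCov μ U t W₁ W₂ := by
  unfold tiltCov; simp only [tiltExp_shiftU]

/-- The third cumulant is invariant under constant shifts of the observables. [folklore] -/
theorem tiltCum3_shift [IsFiniteMeasure μ] [NeZero μ] {U W₁ W₂ : Ω → ℝ} {BU B₁ B₂ : ℝ} (hU : Measurable U)
    (h₁ : Measurable W₁) (h₂ : Measurable W₂) (hUb : ∀ x, |U x| ≤ BU) (h₁b : ∀ x, |W₁ x| ≤ B₁) (h₂b : ∀ x, |W₂ x| ≤ B₂)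
    (a b t : ℝ) :
    tiltCum3 μ U t (fun x => W₁ x - a) (fun x => W₂ x - b) = tiltCum3 μ U t W₁ W₂ := by
  unfold tiltCum3
  rw [tiltExp_sub_const hU h₁ hUb h₁b, tiltExp_sub_const hU h₂ hUb h₂b]
  congr 1; funext x; ring

/-- The third cumulant is invariant under a constant shift of the tilt observable. [folklore] -/
theorem tiltCum3_shiftU [IsFiniteMeasure μ] [NeZero μ] {U : Ω → ℝ} {BU : ℝ} (hU : Measurable U) (hUb : ∀ x, |U x| ≤ BU)
    (c t : ℝ) (W₁ W₂ : Ω → ℝ) :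
    tiltCum3 μ (fun x => U x - c) t W₁ W₂ = tiltCum3 μ U t W₁ W₂ := by
  unfold tiltCum3
  simp only [tiltExp_shiftU]
  rw [tiltExp_sub_const hU hU hUb hUb]
  congr 1; funext x; ring

/-- The fourth cumulant is invariant under constant shifts of the observables. [folklore] -/
theorem tiltCum4_shift [IsFiniteMeasure μ] [NeZero μ] {U W₁ W₂ : Ω → ℝ} {BU B₁ B₂ : ℝ} (hU : Measurable U)
    (h₁ : Measurable W₁) (h₂ : Measurable W₂) (hUb : ∀ x, |U x| ≤ BU) (h₁b : ∀ x, |W₁ x| ≤ B₁) (h₂b : ∀ x, |W₂ x| ≤ B₂)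
    (a b t : ℝ) :
    tiltCum4 μ U t (fun x => W₁ x - a) (fun x => W₂ x - b) = tiltCum4 μ U t W₁ W₂ := by
  unfold tiltCum4
  rw [tiltExp_sub_const hU h₁ hUb h₁b, tiltExp_sub_const hU h₂ hUb h₂b]
  have e1 : (fun x => (W₁ x - a - (tiltExp μ U t W₁ - a)) * (W₂ x - b - (tiltExp μ U t W₂ - b)) * (U x - tiltExp μ U t U) ^ 2) =
      fun x => (W₁ x - tiltExp μ U t W₁) * (W₂ x - tiltExp μ U t W₂) * (U x - tiltExp μ U t U) ^ 2 := by
    funext x; ring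
  have e2 : (fun x => (W₁ x - a - (tiltExp μ U t W₁ - a)) * (W₂ x - b - (tiltExp μ U t W₂ - b))) =
      fun x => (W₁ x - tiltExp μ U t W₁) * (W₂ x - tiltExp μ U t W₂) := by
    funext x; ring
  have e3 : (fun x => (W₁ x - a - (tiltExp μ U t W₁ - a)) * (U x - tiltExp μ U t U)) =
      fun x => (W₁ x - tiltExp μ U t W₁) * (U x - tiltExp μ U t U) := by
    funext x; ring
  have e4 : (fun x => (W₂ x - b - (tiltExp μ U t W₂ - b)) * (U x - tiltExp μ U t U)) =
      fun x => (W₂ x - tiltExp μ U t W₂) * (U x - tiltExp μ U t U) := by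
    funext x; ring
  rw [e1, e2, e3, e4]

/-- The fourth cumulant is invariant under a constant shift of the tilt observable. [folklore] -/
theorem tiltCum4_shiftU [IsFiniteMeasure μ] [NeZero μ] {U : Ω → ℝ} {BU : ℝ} (hU : Measurable U) (hUb : ∀ x, |U x| ≤ BU)
    (c t : ℝ) (W₁ W₂ : Ω → ℝ) :
    tiltCum4 μ (fun x => U x - c) t W₁ W₂ = tiltCum4 μ U t W₁ W₂ := by
  unfold tiltCum4
  simp only [tiltExp_shiftU]
  rw [tiltExp_sub_const hU hU hUb hUb]
  have e1 : (fun x => (W₁ x - tiltExp μ U t W₁) * (W₂ x - tiltExp μ U t W₂) * (U x - c - (tiltExp μ U t U - c)) ^ 2) =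
      fun x => (W₁ x - tiltExp μ U t W₁) * (W₂ x - tiltExp μ U t W₂) * (U x - tiltExp μ U t U) ^ 2 := by
    funext x; ring
  have e2 : (fun x => (U x - c - (tiltExp μ U t U - c)) ^ 2) = fun x => (U x - tiltExp μ U t U) ^ 2 := by
    funext x; ring
  have e3 : (fun x => (W₁ x - tiltExp μ U t W₁) * (U x - c - (tiltExp μ U t U - c))) =
      fun x => (W₁ x - tiltExp μ U t W₁) * (U x - tiltExp μ U t U) := by
    funext x; ring
  have e4 : (fun x => (W₂ x - tiltExp μ U t W₂) * (U x - c - (tiltExp μ U t U - c))) =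
      fun x => (W₂ x - tiltExp μ U t W₂) * (U x - tiltExp μ U t U) := by
    funext x; ring
  rw [e1, e2, e3, e4]

/-! ## §4 Derivatives in the centred case -/

/-- Centred case: `d/dt|_{t₀} Cov_t(W₁,W₂) = E_{t₀}[W₁W₂U] = κ₃,t₀` when `E_{t₀}[W₁] = E_{t₀}[W₂] = E_{t₀}[U] = 0`. [folklore] -/
theorem hasDerivAt_tiltCov_centred [IsFiniteMeasure μ] [NeZero μ] {U W₁ W₂ : Ω → ℝ} {BU B₁ B₂ : ℝ} (hU : Measurable U)
    (h₁ : Measurable W₁) (h₂ : Measurable W₂) (hUb : ∀ x, |U x| ≤ BU) (h₁b : ∀ x, |W₁ x| ≤ B₁) (h₂b : ∀ x, |W₂ x| ≤ B₂)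
    {t₀ : ℝ} (hm₁ : tiltExp μ U t₀ W₁ = 0) (hm₂ : tiltExp μ U t₀ W₂ = 0) (hu : tiltExp μ U t₀ U = 0) :
    HasDerivAt (fun t => tiltCov μ U t W₁ W₂) (tiltCum3 μ U t₀ W₁ W₂) t₀ := by
  have h := hasDerivAt_cov_tilted (μ := μ) hU h₁ h₂ hUb h₁b h₂b t₀
  have e : (fun t => tiltCov μ U t W₁ W₂) = fun t => (∫ x, W₁ x * W₂ x ∂(μ.tilted fun x => t * U x)) -
      (∫ x, W₁ x ∂(μ.tilted fun x => t * U x)) * (∫ x, W₂ x ∂(μ.tilted fun x => t * U x)) := by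
    funext t; unfold tiltCov; simp only [tiltExp_eq_integral_tilted]
  rw [e]
  refine h.congr_deriv ?_
  rw [tiltExp_eq_integral_tilted] at hm₁ hm₂ hu
  rw [hm₁, hm₂, hu]
  unfold tiltCum3
  rw [tiltExp_eq_integral_tilted, tiltExp_eq_integral_tilted, tiltExp_eq_integral_tilted, tiltExp_eq_integral_tilted, hm₁, hm₂, hu]
  simp only [sub_zero, zero_mul, mul_zero, add_zero]

/-- The 8-term raw expansion of the third cumulant:
`κ₃,t = E[W₁W₂U] − u·E[W₁W₂] − m₂·E[W₁U] − m₁·E[W₂U] + 2 m₁ m₂ u`. [folklore] -/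
theorem tiltCum3_eq_raw [IsFiniteMeasure μ] [NeZero μ] {U W₁ W₂ : Ω → ℝ} {BU B₁ B₂ : ℝ} (hU : Measurable U)
    (h₁ : Measurable W₁) (h₂ : Measurable W₂) (hUb : ∀ x, |U x| ≤ BU) (h₁b : ∀ x, |W₁ x| ≤ B₁) (h₂b : ∀ x, |W₂ x| ≤ B₂)
    (t : ℝ) :
    tiltCum3 μ U t W₁ W₂ =
      tiltExp μ U t (fun x => W₁ x * W₂ x * U x) - tiltExp μ U t U * tiltExp μ U t (fun x => W₁ x * W₂ x)
        - tiltExp μ U t W₂ * tiltExp μ U t (fun x => W₁ x * U x) - tiltExp μ U t W₁ * tiltExp μ U t (fun x => W₂ x * U x)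
        + 2 * (tiltExp μ U t W₁ * tiltExp μ U t W₂ * tiltExp μ U t U) := by
  haveI := isProbabilityMeasure_tilted_mul (μ := μ) hU hUb t
  unfold tiltCum3
  simp only [tiltExp_eq_integral_tilted]
  set ν := μ.tilted fun x => t * U x
  set m₁ := ∫ x, W₁ x ∂ν
  set m₂ := ∫ x, W₂ x ∂ν
  set u := ∫ x, U x ∂ν
  have i12U : Integrable (fun x => W₁ x * W₂ x * U x) ν :=
    integrable_of_abs_le ((h₁.mul h₂).mul hU) (abs_mul_mul_le h₁b h₂b hUb)
  have i12 : Integrable (fun x => u * (W₁ x * W₂ x)) ν :=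
    (integrable_of_abs_le (h₁.mul h₂) (abs_mul_le_mul h₁b h₂b)).const_mul u
  have i1U : Integrable (fun x => m₂ * (W₁ x * U x)) ν :=
    (integrable_of_abs_le (h₁.mul hU) (abs_mul_le_mul h₁b hUb)).const_mul m₂
  have i2U : Integrable (fun x => m₁ * (W₂ x * U x)) ν :=
    (integrable_of_abs_le (h₂.mul hU) (abs_mul_le_mul h₂b hUb)).const_mul m₁
  have i1 : Integrable (fun x => m₂ * u * W₁ x) ν := (integrable_of_abs_le h₁ h₁b).const_mul _
  have i2 : Integrable (fun x => m₁ * u * W₂ x) ν := (integrable_of_abs_le h₂ h₂b).const_mul _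
  have iU : Integrable (fun x => m₁ * m₂ * U x) ν := (integrable_of_abs_le hU hUb).const_mul _
  have e : (fun x => (W₁ x - m₁) * (W₂ x - m₂) * (U x - u)) = fun x =>
      W₁ x * W₂ x * U x - u * (W₁ x * W₂ x) - m₂ * (W₁ x * U x) - m₁ * (W₂ x * U x)
        + m₂ * u * W₁ x + m₁ * u * W₂ x + m₁ * m₂ * U x - m₁ * m₂ * u := by
    funext x; ring
  rw [e]
  have iS1 : Integrable (fun x => W₁ x * W₂ x * U x - u * (W₁ x * W₂ x)) ν := i12U.sub i12
  have iS2 : Integrable (fun x => W₁ x * W₂ x * U x - u * (W₁ x * W₂ x) - m₂ * (W₁ x * U x)) ν := iS1.sub i1U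
  have iS3 : Integrable (fun x => W₁ x * W₂ x * U x - u * (W₁ x * W₂ x) - m₂ * (W₁ x * U x) - m₁ * (W₂ x * U x)) ν :=
    iS2.sub i2U
  have iS4 : Integrable (fun x => W₁ x * W₂ x * U x - u * (W₁ x * W₂ x) - m₂ * (W₁ x * U x) - m₁ * (W₂ x * U x)
      + m₂ * u * W₁ x) ν := iS3.add i1
  have iS5 : Integrable (fun x => W₁ x * W₂ x * U x - u * (W₁ x * W₂ x) - m₂ * (W₁ x * U x) - m₁ * (W₂ x * U x)
      + m₂ * u * W₁ x + m₁ * u * W₂ x) ν := iS4.add i2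
  have iS6 : Integrable (fun x => W₁ x * W₂ x * U x - u * (W₁ x * W₂ x) - m₂ * (W₁ x * U x) - m₁ * (W₂ x * U x)
      + m₂ * u * W₁ x + m₁ * u * W₂ x + m₁ * m₂ * U x) ν := iS5.add iU
  rw [integral_sub iS6 (integrable_const _), integral_add iS5 iU, integral_add iS4 i2, integral_add iS3 i1,
    integral_sub iS2 i2U, integral_sub iS1 i1U, integral_sub i12U i12,
    integral_const_mul, integral_const_mul, integral_const_mul, integral_const_mul, integral_const_mul, integral_const_mul]
  simp only [integral_const, measure_univ, ENNReal.toReal_one, smul_eq_mul, Measure.real]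
  ring

/-- Centred case: `d/dt|_{t₀} κ₃,t = κ₄,t₀` when `E_{t₀}[W₁] = E_{t₀}[W₂] = E_{t₀}[U] = 0`. [folklore] -/
theorem hasDerivAt_tiltCum3_centred [IsFiniteMeasure μ] [NeZero μ] {U W₁ W₂ : Ω → ℝ} {BU B₁ B₂ : ℝ} (hU : Measurable U)
    (h₁ : Measurable W₁) (h₂ : Measurable W₂) (hUb : ∀ x, |U x| ≤ BU) (h₁b : ∀ x, |W₁ x| ≤ B₁) (h₂b : ∀ x, |W₂ x| ≤ B₂)
    {t₀ : ℝ} (hm₁ : tiltExp μ U t₀ W₁ = 0) (hm₂ : tiltExp μ U t₀ W₂ = 0) (hu : tiltExp μ U t₀ U = 0) :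
    HasDerivAt (fun t => tiltCum3 μ U t W₁ W₂) (tiltCum4 μ U t₀ W₁ W₂) t₀ := by
  have e : (fun t => tiltCum3 μ U t W₁ W₂) = fun t =>
      tiltExp μ U t (fun x => W₁ x * W₂ x * U x) - tiltExp μ U t U * tiltExp μ U t (fun x => W₁ x * W₂ x)
        - tiltExp μ U t W₂ * tiltExp μ U t (fun x => W₁ x * U x) - tiltExp μ U t W₁ * tiltExp μ U t (fun x => W₂ x * U x)
        + 2 * (tiltExp μ U t W₁ * tiltExp μ U t W₂ * tiltExp μ U t U) := by
    funext t; exact tiltCum3_eq_raw hU h₁ h₂ hUb h₁b h₂b t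
  rw [e]
  -- derivatives of the seven raw moments
  have d12U := hasDerivAt_tiltExp (μ := μ) (W := fun x => W₁ x * W₂ x * U x) hU ((h₁.mul h₂).mul hU) hUb
    (abs_mul_mul_le h₁b h₂b hUb) t₀
  have d12 := hasDerivAt_tiltExp (μ := μ) (W := fun x => W₁ x * W₂ x) hU (h₁.mul h₂) hUb (abs_mul_le_mul h₁b h₂b) t₀
  have d1U := hasDerivAt_tiltExp (μ := μ) (W := fun x => W₁ x * U x) hU (h₁.mul hU) hUb (abs_mul_le_mul h₁b hUb) t₀
  have d2U := hasDerivAt_tiltExp (μ := μ) (W := fun x => W₂ x * U x) hU (h₂.mul hU) hUb (abs_mul_le_mul h₂b hUb) t₀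
  have d1 := hasDerivAt_tiltExp (μ := μ) hU h₁ hUb h₁b t₀
  have d2 := hasDerivAt_tiltExp (μ := μ) hU h₂ hUb h₂b t₀
  have dU := hasDerivAt_tiltExp (μ := μ) hU hU hUb hUb t₀
  have key := (((d12U.sub (dU.mul d12)).sub (d2.mul d1U)).sub (d1.mul d2U)).add (((d1.mul d2).mul dU).const_mul 2)
  refine key.congr_deriv ?_
  simp only [Pi.mul_apply]
  unfold tiltCum4
  simp only [hm₁, hm₂, hu, sub_zero, zero_mul, mul_zero, add_zero]
  have f1 : (fun x => W₁ x * W₂ x * U x * U x) = fun x => W₁ x * W₂ x * U x ^ 2 := by funext x; ring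
  have f3 : (fun x => U x * U x) = fun x => U x ^ 2 := by funext x; ring
  rw [f1, f3]
  ring

/-! ## §5 General case by re-centring -/

/-- **`d/dt Cov_t(G₁,G₂) = κ₃,t(G₁,G₂,U)`** at every `t₀` (bounded measurable data, finite non-zero `μ`). [folklore] -/
theorem hasDerivAt_tiltCov [IsFiniteMeasure μ] [NeZero μ] {U G₁ G₂ : Ω → ℝ} {BU B₁ B₂ : ℝ} (hU : Measurable U)
    (h₁ : Measurable G₁) (h₂ : Measurable G₂) (hUb : ∀ x, |U x| ≤ BU) (h₁b : ∀ x, |G₁ x| ≤ B₁) (h₂b : ∀ x, |G₂ x| ≤ B₂)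
    (t₀ : ℝ) : HasDerivAt (fun t => tiltCov μ U t G₁ G₂) (tiltCum3 μ U t₀ G₁ G₂) t₀ := by
  set a := tiltExp μ U t₀ G₁
  set b := tiltExp μ U t₀ G₂
  set c := tiltExp μ U t₀ U
  -- the re-centred data
  have hV : Measurable fun x => U x - c := hU.sub measurable_const
  have hW₁ : Measurable fun x => G₁ x - a := h₁.sub measurable_const
  have hW₂ : Measurable fun x => G₂ x - b := h₂.sub measurable_const
  have hVb : ∀ x, |U x - c| ≤ BU + |c| := fun x => (abs_sub _ _).trans (by linarith [hUb x])
  have hW₁b : ∀ x, |G₁ x - a| ≤ B₁ + |a| := fun x => (abs_sub _ _).trans (by linarith [h₁b x])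
  have hW₂b : ∀ x, |G₂ x - b| ≤ B₂ + |b| := fun x => (abs_sub _ _).trans (by linarith [h₂b x])
  have e : (fun t => tiltCov μ U t G₁ G₂) = fun t => tiltCov μ (fun x => U x - c) t (fun x => G₁ x - a) (fun x => G₂ x - b) := by
    funext t
    rw [tiltCov_shiftU, tiltCov_shift hU h₁ h₂ hUb h₁b h₂b]
  have e3 : tiltCum3 μ U t₀ G₁ G₂ = tiltCum3 μ (fun x => U x - c) t₀ (fun x => G₁ x - a) (fun x => G₂ x - b) := by
    rw [tiltCum3_shiftU hU hUb, tiltCum3_shift hU h₁ h₂ hUb h₁b h₂b]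
  rw [e, e3]
  refine hasDerivAt_tiltCov_centred hV hW₁ hW₂ hVb hW₁b hW₂b ?_ ?_ ?_
  · rw [tiltExp_shiftU, tiltExp_sub_const hU h₁ hUb h₁b]; exact sub_self a
  · rw [tiltExp_shiftU, tiltExp_sub_const hU h₂ hUb h₂b]; exact sub_self b
  · rw [tiltExp_shiftU, tiltExp_sub_const hU hU hUb hUb]; exact sub_self c

/-- **`d/dt κ₃,t(G₁,G₂,U) = κ₄,t(G₁,G₂,U,U)`** at every `t₀` (bounded measurable data, finite non-zero `μ`). [folklore] -/
theorem hasDerivAt_tiltCum3 [IsFiniteMeasure μ] [NeZero μ] {U G₁ G₂ : Ω → ℝ} {BU B₁ B₂ : ℝ} (hU : Measurable U)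
    (h₁ : Measurable G₁) (h₂ : Measurable G₂) (hUb : ∀ x, |U x| ≤ BU) (h₁b : ∀ x, |G₁ x| ≤ B₁) (h₂b : ∀ x, |G₂ x| ≤ B₂)
    (t₀ : ℝ) : HasDerivAt (fun t => tiltCum3 μ U t G₁ G₂) (tiltCum4 μ U t₀ G₁ G₂) t₀ := by
  set a := tiltExp μ U t₀ G₁
  set b := tiltExp μ U t₀ G₂
  set c := tiltExp μ U t₀ U
  have hV : Measurable fun x => U x - c := hU.sub measurable_const
  have hW₁ : Measurable fun x => G₁ x - a := h₁.sub measurable_const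
  have hW₂ : Measurable fun x => G₂ x - b := h₂.sub measurable_const
  have hVb : ∀ x, |U x - c| ≤ BU + |c| := fun x => (abs_sub _ _).trans (by linarith [hUb x])
  have hW₁b : ∀ x, |G₁ x - a| ≤ B₁ + |a| := fun x => (abs_sub _ _).trans (by linarith [h₁b x])
  have hW₂b : ∀ x, |G₂ x - b| ≤ B₂ + |b| := fun x => (abs_sub _ _).trans (by linarith [h₂b x])
  have e : (fun t => tiltCum3 μ U t G₁ G₂) = fun t => tiltCum3 μ (fun x => U x - c) t (fun x => G₁ x - a) (fun x => G₂ x - b) := by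
    funext t
    rw [tiltCum3_shiftU hU hUb, tiltCum3_shift hU h₁ h₂ hUb h₁b h₂b]
  have e4 : tiltCum4 μ U t₀ G₁ G₂ = tiltCum4 μ (fun x => U x - c) t₀ (fun x => G₁ x - a) (fun x => G₂ x - b) := by
    rw [tiltCum4_shiftU hU hUb, tiltCum4_shift hU h₁ h₂ hUb h₁b h₂b]
  rw [e, e4]
  refine hasDerivAt_tiltCum3_centred hV hW₁ hW₂ hVb hW₁b hW₂b ?_ ?_ ?_
  · rw [tiltExp_shiftU, tiltExp_sub_const hU h₁ hUb h₁b]; exact sub_self a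
  · rw [tiltExp_shiftU, tiltExp_sub_const hU h₂ hUb h₂b]; exact sub_self b
  · rw [tiltExp_shiftU, tiltExp_sub_const hU hU hUb hUb]; exact sub_self c

/-! ## §6 Second-order Taylor bound on `[0,1]` -/

/-- `|f 1 − f 0 − f′ 0| ≤ K/2` for a twice differentiable `f : ℝ → ℝ` with `|f″| ≤ K` on `[0,1]`. [folklore] -/
theorem abs_sub_sub_le_of_second_deriv {f f' f'' : ℝ → ℝ} (hf : ∀ t, HasDerivAt f (f' t) t)
    (hf' : ∀ t, HasDerivAt f' (f'' t) t) {K : ℝ} (hK : ∀ t ∈ Icc (0 : ℝ) 1, |f'' t| ≤ K) :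
    |f 1 - f 0 - f' 0| ≤ K / 2 := by
  -- `|f′ t − f′ 0| ≤ K t` on `[0,1]`
  have h1 : ∀ t ∈ Icc (0 : ℝ) 1, ‖f' t - f' 0‖ ≤ K * (t - 0) := by
    refine norm_image_sub_le_of_norm_deriv_right_le_segment (f := f') (f' := f'')
      (fun t _ => (hf' t).continuousAt.continuousWithinAt) (fun t _ => (hf' t).hasDerivWithinAt) ?_
    intro t ht
    rw [Real.norm_eq_abs]
    exact hK t ⟨ht.1, ht.2.le⟩
  -- `g t = f t − f 0 − t f′ 0`, `g′ = f′ t − f′ 0`, `‖g t‖ ≤ K t²/2`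
  have hgd : ∀ t, HasDerivAt (fun t => f t - f 0 - t * f' 0) (f' t - f' 0) t := by
    intro t
    have h1 : HasDerivAt (fun y : ℝ => y * f' 0) (1 * f' 0) t := (hasDerivAt_id t).mul_const (f' 0)
    rw [one_mul] at h1
    exact ((hf t).sub_const (f 0)).sub h1
  have hB : ∀ t, HasDerivAt (fun t : ℝ => K * t ^ 2 / 2) (K * t) t := by
    intro t
    have := ((hasDerivAt_pow 2 t).const_mul K).div_const 2
    refine this.congr_deriv ?_
    push_cast
    ring
  have h2 := image_norm_le_of_norm_deriv_right_le_deriv_boundary (f := fun t => f t - f 0 - t * f' 0)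
    (f' := fun t => f' t - f' 0) (a := 0) (b := 1)
    (fun t _ => (hgd t).continuousAt.continuousWithinAt) (fun t _ => (hgd t).hasDerivWithinAt)
    (B := fun t => K * t ^ 2 / 2) (B' := fun t => K * t) (by simp) hB
    (fun t ht => by have := h1 t ⟨ht.1, ht.2.le⟩; simpa using this)
  have h3 := h2 (x := 1) ⟨zero_le_one, le_rfl⟩
  simp only [Real.norm_eq_abs, one_mul, one_pow, mul_one] at h3
  exact h3

end Tilt


/-- ★★ **T-S5.13t `tiltSecondOrder : TiltSecondOrder`** (planner ym-idea-2 g18's typed Prop, BY NAME): for a finite measure `μ ≠ 0` and bounded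
measurable `U, G₁, G₂`, `|Cov₁(G₁,G₂) − Cov₀(G₁,G₂) − κ₃,₀(G₁,G₂,U)| ≤ K/2` whenever `|κ₄,t(G₁,G₂,U,U)| ≤ K` on `[0,1]` — `f′ = κ₃,t`
(`Tilt.hasDerivAt_tiltCov`), `f″ = κ₄,t` (`Tilt.hasDerivAt_tiltCum3`), Taylor (`Tilt.abs_sub_sub_le_of_second_deriv`). [folklore] -/
theorem tiltSecondOrder : TiltSecondOrder := by
  intro Ω _ μ _ hμ U G₁ G₂ hU h₁ h₂ hB K hK
  obtain ⟨B, hB⟩ := hB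
  haveI : NeZero μ := ⟨hμ⟩
  have hUb : ∀ x, |U x| ≤ B := fun x => (hB x).1
  have h₁b : ∀ x, |G₁ x| ≤ B := fun x => (hB x).2.1
  have h₂b : ∀ x, |G₂ x| ≤ B := fun x => (hB x).2.2
  exact Tilt.abs_sub_sub_le_of_second_deriv (f := fun t => Tilt.tiltCov μ U t G₁ G₂) (f' := fun t => Tilt.tiltCum3 μ U t G₁ G₂)
    (f'' := fun t => Tilt.tiltCum4 μ U t G₁ G₂)
    (fun t => Tilt.hasDerivAt_tiltCov hU h₁ h₂ hUb h₁b h₂b t) (fun t => Tilt.hasDerivAt_tiltCum3 hU h₁ h₂ hUb h₁b h₂b t) hK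

end Summit.QuantumFields.YangMills.Theorems.AllWindowsColdBoxBoxHighLine

end
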